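import Literature.MathematicalPhysics.QuantumFieldTheory.Balaban1983to89.B1Sect3Statements

/-!
# `Balaban1983to89.B1Ineq367Proof` — T. Bałaban, *(Higgs)₂,₃ quantum fields in a finite volume. I. A lower bound*,
Commun. Math. Phys. **85** (1982) 603–626 [Balaban1982Higgs1]: the last assembly before the Gaussian computation, **(3.26) at
k = K ⇒ (3.66) ⇒ (3.67)** pp. 624–625: expanding the K-th action in the small field `A^{(K)}` (Prop. 3.1) and bounding the
interaction `V^{(K)}` (Prop. 3.2) — displayed as hypotheses on the support of `χ_K(A)χ_K(φ)` — and replacing `χ_K` by the explicit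
small-field characteristic functions `χ({|A(x)| ≤ c₁⁻¹(L^Kε)^{−(d−2)/2}p(L^Kε)})` (PROVED from the `c₁`-regularity of `A ↦ A^{(K)}`),
PLUS the kernel-checked arithmetic behind *"exp(Σ_{j=0}^{K−1}O(1)(L^jε)^{κ₀}|T_ε|) = exp(O(1)|T_ε|)"* (the accumulated errors of
(3.26) are uniformly bounded: `Σ_{j<K}(L^jε)^{κ₀} ≤ (L^Kε)^{κ₀}/(L^{κ₀} − 1) ≤ ε₀^{κ₀}/(L^{κ₀} − 1)`); theorems only

statement-level skeleton of published theorems with citation tags; proofs where landed; nothing here is a claim about the Yang–Mills mass gap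

PDF held: `paper:balaban1982-cmp85-higgs23-i` (journal page = PDF page + 602); (3.66) p. 624 and (3.67) p. 625 READ AS IMAGES on
the x2 renders `run/shared/lean/pub/pub-balaban/b2b-balaban-ref1/pages/1982-cmp85-higgs23-I/…-p022-x2.png`, `…-p023-x2.png`;
(3.26)–(3.30) p. 617 `…-p015-x2.png`.

CITATION HEADER (lean-in-tree rule).  WHAT IS REPRODUCED — SKELETON row **B1.Eq3.66–3.67** (reader r12
`lit-balaban-r12/ROWS-B1-part2.md`: «K with L^Kε ≤ ε₀ < L^{K+1}ε; expand in A^{(K)ε} (Prop 3.1), ∣V^{(K)ε}∣ ≤ O(1)(L^Kε)^{κ₀}∣T₁^{(K)}∣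
(Prop 3.2): Z^ε ≥ ∫dA∫dφ χ_Kχ_KZ_KZ_K(0)exp[…] ≥ (3.67) with thresholds c₁⁻¹(L^Kε)^{−(d−2)/2}p(L^Kε); absent · integral
inequalities (assembly)»).  Verbatim, p. 624 [PDF 22]: *"Now we can finish the proof of the lower bound. We take K such that L^Kε ≤
ε₀, but L^{K+1}ε > ε₀, and then we have (3.26)–(3.32) with k = K. We use the fact that the field A^{(K)ε} is small and we expand
the whole action with respect to this field. We use Proposition 3.1 for this expansion and we get Z^ε ≥ ∫dA∫dφ
χ_K(A)χ_K(φ)Z_KZ_K(0)exp[−½⟨A, Δ^{(K),L^Kε}A⟩ − ½⟨φ, Δ^{(K),L^Kε}(0)φ⟩ + V^{(K)ε}(0, 0; A, φ) − E₀ + O(1)|T_ε|]. (3.66)"*;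
p. 625 [PDF 23]: *"Using representation (3.57) in Proposition 3.2 and the restrictions on the fields A, φ we can estimate the
absolute value of the interaction V^{(K)ε} by O(1)(L^Kε)^{κ₀}|T₁^{(K)}|. Further we can estimate Z^ε ≥ ∫dA∫dφ Π_{x∈T^{(K)}_{L^Kε}}
χ({|A(x)| ≤ c₁⁻¹(L^Kε)^{−(d−2)/2}p(L^Kε)})·χ({|φ(x)| ≤ c₁⁻¹(L^Kε)^{−(d−2)/2}p(L^Kε)})Z_KZ_K(0)·exp[−½⟨A, Δ^{(K),L^Kε}A⟩ − ½⟨φ,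
Δ^{(K),L^Kε}(0)φ⟩ − E₀ + O(1)|T_ε|]. (3.67)"*; (3.26) p. 617: *"Z^ε ≥ ∫dA∫dφ χ_k(A)χ_k(φ)exp(−S^{(k),L^kε}(A, φ) + Σ_{j=0}^{k−1}
O(1)(L^jε)^{κ₀}|T_ε|) (3.26)"*.

THE MODEL (schematic, as in the siblings `B1Ineq351Proof`/`B1Ineq353Proof`): ONE measure space `(Ω, μ)` for the pair of
block fields `ω = (A, φ)` on `T^{(K)}_{L^Kε}` (`μ` ↤ `dA dφ`); real functions of the configuration: `S` ↤ `S^{(K),L^Kε}`, `qA` ↤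
`⟨A, Δ^{(K)}A⟩`, `qφ0` ↤ `⟨φ, Δ^{(K)}(0)φ⟩`, `V` ↤ `V^{(K)ε}(0,0;A,φ)`, the cut-offs `χK` ↤ `χ_K(A)χ_K(φ)` and `χsm` ↤ the product
of the explicit characteristic functions of (3.67), both `[0,1]`-valued; numbers `ZK` ↤ `Z_KZ_K(0) ≥ 0`, `E₀`, `vol` ↤ `|T_ε|`,
`errK` ↤ `Σ_{j<K}(L^jε)^{κ₀}`.  The three printed analytic inputs are hypotheses ON THE SUPPORT of `χK`: (E1) the expansion of
p. 624 (Prop. 3.1, with (3.30)–(3.32), (3.46)–(3.47)): `exp(−S) ≥ ZK·exp(−½qA − ½qφ0 + V − E₀ − C₁·vol)`; (E2) Prop. 3.2: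
`|V| ≤ C₂·vol`; (E3) the regularity of `A ↦ A^{(K)}` (constant `c₁`): `χsm ≤ χK` — this one is PROVED in §1 from the
sup-norm form of the hypothesis (`chiK_of_small`).

WHAT THIS FILE PROVES (theorems only — no `def`, no new `Prop` fact; 0 `sorry`; standard axioms):
* **`chiK_of_small`** — (E3): if `|A(x)| ≤ c₁⁻¹s^{−(d−2)/2}p` for all `x` and `A ↦ A^{(K)}` satisfies `‖A^{(K)}‖_∞ ≤ c₁‖A‖_∞`,
  `‖ΔA^{(K)}‖_∞ ≤ c₁s⁻²‖A‖_∞` (`c₁ > 0`, `s = L^Kε > 0`), then `χ_K(A) = 1` (`B1LowerBound.SmallFieldAt d s p` at every site);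
  `indicator_le_of_imp` — hence the {0,1}-indicators satisfy `χsm ≤ χK`;
* `ineq366` — (3.26)_K + (E1) ⇒ **(3.66)**: `Z^ε ≥ e^{−C·errK·vol}·∫ χK·ZK·exp(−½qA − ½qφ0 + V − E₀ − C₁vol) dμ`;
* **`ineq367`** — + (E2) + (E3) ⇒ **(3.67)**: `Z^ε ≥ e^{−C·errK·vol}·∫ χsm·ZK·exp(−½qA − ½qφ0 − E₀ − (C₁ + C₂)vol) dμ`;
* **`sum_scalePow_le`**, `sum_scalePow_le_eps0` — `Σ_{j<K}(L^jε)^{κ₀} ≤ (L^Kε)^{κ₀}/(L^{κ₀} − 1) ≤ ε₀^{κ₀}/(L^{κ₀} − 1)` for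
  `L > 1`, `κ₀ > 0`, `0 < ε`, `L^Kε ≤ ε₀`; **`ineq367_O1`** — (3.67) with ONE explicit `O(1) = C₁ + C₂ + C·ε₀^{κ₀}/(L^{κ₀} − 1)`
  multiplying `|T_ε|`, uniform in `K` and `ε` (*"a constant O(1) which in general depends on L^Kε, thus on ε₀"*).
HONEST SCOPE.  (E1), (E2) and the sup-norm regularity are the paper's analytic inputs (Props. 3.1/3.2, Props. 2.2/2.3) and
stay hypotheses; the next step (3.68)–(3.69) (the Gaussian integral over the small-field box and the determinant–trace
chain) is NOT here (row B1.Eq3.68–3.69).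
Unit `lit-balaban-p14` gen 3 (Phase-2 proof seat p14, literature-prover-lit-balaban-p14-g3-0), HOME
`run/shared/lean/pub/lit-balaban/` (seat log `lit-balaban-p14/STATUS.md`).
-/

namespace Literature.MathematicalPhysics.QuantumFieldTheory.Balaban1983to89.B1Ineq367Proof

open Literature.MathematicalPhysics.QuantumFieldTheory.Balaban1983to89
open B1LowerBound B1Sect3Statements MeasureTheory Finset

/-! ## §1 (E3): small fields are K-regular — the explicit cut-offs of (3.67) imply `χ_K` -/

section SmallField

variable {Z X U V : Type} [NormedAddCommGroup V] [NormedSpace ℝ V]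

/-- **The replacement `χ_K ↦ χ({|A(x)| ≤ c₁⁻¹(L^Kε)^{−(d−2)/2}p(L^Kε)})` of (3.67)**: if every site value of the block field is
bounded by `c₁⁻¹s^{−(d−2)/2}p` (`s = L^Kε`, `p = p(L^Kε)`) and the background-field map `A ↦ A^{(K)} = a_Ks⁻²G_KQ*_KA` (3.29)
and its Laplacian are sup-norm bounded with constant `c₁` in the natural scaling (`‖A^{(K)}(z)‖ ≤ c₁M`, `‖(ΔA^{(K)})(z)‖ ≤
c₁s⁻²M` whenever `‖A(x)‖ ≤ M` for all `x` — the regularity of Props. 2.2/2.3), then the restriction (3.27) `χ_K(A) = 1` holds: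
`‖A^{(K)}(z)‖ ≤ s^{−(d−2)/2}p`, `‖(ΔA^{(K)})(z)‖ ≤ s^{−(d+2)/2}p` at every site (`B1LowerBound.SmallFieldAt`).  The same for `φ`
with `G_K(A^{(K)}), Q*_K(A^{(K)})` and the covariant Laplacian. [cite: Balaban1982Higgs1, (3.67) p.625] -/
theorem chiK_of_small (G lap : (Z → V) →ₗ[ℝ] (Z → V)) (Qs : (X → V) →ₗ[ℝ] (Z → V)) {aK s c₁ p : ℝ} {d : ℕ}
    (hs : 0 < s) (hc₁ : 0 < c₁)
    (hreg : ∀ (A : X → V) (M : ℝ), (∀ x, ‖A x‖ ≤ M) →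
      ∀ z, ‖bgField aK s G Qs A z‖ ≤ c₁ * M ∧ ‖lap (bgField aK s G Qs A) z‖ ≤ c₁ * (s ^ 2)⁻¹ * M)
    {A : X → V} (hA : ∀ x, ‖A x‖ ≤ c₁⁻¹ * s ^ (-(((d : ℝ) - 2) / 2)) * p) (z : Z) :
    SmallFieldAt d s p ‖bgField aK s G Qs A z‖ ‖lap (bgField aK s G Qs A) z‖ := by
  obtain ⟨h1, h2⟩ := hreg A _ hA z
  refine ⟨?_, ?_⟩
  · calc ‖bgField aK s G Qs A z‖ ≤ c₁ * (c₁⁻¹ * s ^ (-(((d : ℝ) - 2) / 2)) * p) := h1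
      _ = s ^ (-(((d : ℝ) - 2) / 2)) * p := by field_simp
  · have hpow : (s ^ 2)⁻¹ * s ^ (-(((d : ℝ) - 2) / 2)) = s ^ (-(((d : ℝ) + 2) / 2)) := by
      rw [← Real.rpow_natCast s 2, ← Real.rpow_neg hs.le, ← Real.rpow_add hs, Nat.cast_ofNat]
      congr 1
      ring
    calc ‖lap (bgField aK s G Qs A) z‖ ≤ c₁ * (s ^ 2)⁻¹ * (c₁⁻¹ * s ^ (-(((d : ℝ) - 2) / 2)) * p) := h2
      _ = ((s ^ 2)⁻¹ * s ^ (-(((d : ℝ) - 2) / 2))) * p := by field_simp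
      _ = s ^ (-(((d : ℝ) + 2) / 2)) * p := by rw [hpow]

/-- {0,1}-valued characteristic functions: if `P → Q` then `𝟙_P ≤ 𝟙_Q` — the pointwise form of *"χ_K(A)χ_K(φ) ≥ Πχ({|A(x)| ≤
…})·Πχ({|φ(x)| ≤ …})"* used between (3.66) and (3.67). [cite: Balaban1982Higgs1, (3.67) p.625] -/
theorem indicator_le_of_imp (P Q : Prop) [Decidable P] [Decidable Q] (h : P → Q) :
    (if P then (1 : ℝ) else 0) ≤ (if Q then (1 : ℝ) else 0) := by
  by_cases hP : P
  · simp [hP, h hP]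
  · by_cases hQ : Q <;> simp [hP, hQ]

end SmallField

/-! ## §2 (3.26)_K ⇒ (3.66) ⇒ (3.67) -/

section Assembly

variable {Ω : Type*} [MeasurableSpace Ω] (μ : Measure Ω)

/-- **(3.66) p. 624** from (3.26) at `k = K` and the expansion (E1): if `(∫ χK·e^{−S} dμ)·e^{−C·errK·vol} ≤ Z^ε` (the typed (3.26),
`errK = Σ_{j<K}(L^jε)^{κ₀}`), and on the support of `χK` the expanded lower bound `ZK·exp(−½qA − ½qφ0 + V − E₀ − C₁vol) ≤ e^{−S}`
holds (Prop. 3.1 with (3.30)–(3.32), (3.46)–(3.47); `ZK = Z_KZ_K(0) ≥ 0`), then `(∫ χK·ZK·exp(−½qA − ½qφ0 + V − E₀ − C₁vol) dμ)·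
e^{−C·errK·vol} ≤ Z^ε` (`χK ∈ [0,1]`, `χK·e^{−S}` integrable). [cite: Balaban1982Higgs1, (3.66) p.624] -/
theorem ineq366 {S qA qφ0 V χK : Ω → ℝ} {Z ZK E₀ C C₁ vol errK : ℝ} (hZK : 0 ≤ ZK)
    (h326 : (∫ ω, χK ω * Real.exp (-S ω) ∂μ) * Real.exp (-(C * errK * vol)) ≤ Z)
    (hχK : ∀ ω, χK ω ∈ Set.Icc (0 : ℝ) 1) (hint : Integrable (fun ω => χK ω * Real.exp (-S ω)) μ)
    (hE1 : ∀ ω, χK ω ≠ 0 →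
      ZK * Real.exp (-(qA ω) / 2 - qφ0 ω / 2 + V ω - E₀ - C₁ * vol) ≤ Real.exp (-S ω)) :
    (∫ ω, χK ω * (ZK * Real.exp (-(qA ω) / 2 - qφ0 ω / 2 + V ω - E₀ - C₁ * vol)) ∂μ)
        * Real.exp (-(C * errK * vol)) ≤ Z := by
  refine le_trans (mul_le_mul_of_nonneg_right ?_ (Real.exp_nonneg _)) h326
  refine integral_mono_of_nonneg (Filter.Eventually.of_forall fun ω =>
    mul_nonneg (hχK ω).1 (mul_nonneg hZK (Real.exp_nonneg _))) hint (Filter.Eventually.of_forall fun ω => ?_)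
  by_cases h0 : χK ω = 0
  · simp [h0]
  · exact mul_le_mul_of_nonneg_left (hE1 ω h0) (hχK ω).1

/-- **(3.67) p. 625** from (3.26)_K, (E1), (E2) `|V^{(K)}| ≤ C₂|T_ε|` on the support of `χ_K` (Prop. 3.2: *"we can estimate the
absolute value of the interaction V^{(K)ε} by O(1)(L^Kε)^{κ₀}|T₁^{(K)}|"*) and (E3) `χsm ≤ χK` (the explicit small-field cut-offs
imply `χ_K`, §1): `(∫ χsm·ZK·exp(−½qA − ½qφ0 − E₀) dμ)·e^{−(C₁+C₂)vol}·e^{−C·errK·vol} ≤ Z^ε` — the printed (3.67) with its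
`O(1)|T_ε|` written out as `−(C₁ + C₂)|T_ε| − C·errK·|T_ε|`. [cite: Balaban1982Higgs1, (3.67) p.625] -/
theorem ineq367 {S qA qφ0 V χK χsm : Ω → ℝ} {Z ZK E₀ C C₁ C₂ vol errK : ℝ} (hZK : 0 ≤ ZK)
    (h326 : (∫ ω, χK ω * Real.exp (-S ω) ∂μ) * Real.exp (-(C * errK * vol)) ≤ Z)
    (hχK : ∀ ω, χK ω ∈ Set.Icc (0 : ℝ) 1) (hint : Integrable (fun ω => χK ω * Real.exp (-S ω)) μ)
    (hE1 : ∀ ω, χK ω ≠ 0 →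
      ZK * Real.exp (-(qA ω) / 2 - qφ0 ω / 2 + V ω - E₀ - C₁ * vol) ≤ Real.exp (-S ω))
    (hE2 : ∀ ω, χK ω ≠ 0 → |V ω| ≤ C₂ * vol)
    (hχsm0 : ∀ ω, 0 ≤ χsm ω) (hE3 : ∀ ω, χsm ω ≤ χK ω) :
    (∫ ω, χsm ω * (ZK * Real.exp (-(qA ω) / 2 - qφ0 ω / 2 - E₀)) ∂μ)
        * Real.exp (-((C₁ + C₂) * vol)) * Real.exp (-(C * errK * vol)) ≤ Z := by
  refine le_trans (mul_le_mul_of_nonneg_right ?_ (Real.exp_nonneg _)) h326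
  rw [← integral_mul_const]
  refine integral_mono_of_nonneg (Filter.Eventually.of_forall fun ω =>
    mul_nonneg (mul_nonneg (hχsm0 ω) (mul_nonneg hZK (Real.exp_nonneg _))) (Real.exp_nonneg _)) hint
    (Filter.Eventually.of_forall fun ω => ?_)
  by_cases h0 : χK ω = 0
  · have hsm : χsm ω = 0 := le_antisymm (h0 ▸ hE3 ω) (hχsm0 ω)
    simp [h0, hsm]
  · -- on the support of `χ_K`: use (E2) then (E1), then `χsm ≤ χK`
    obtain ⟨hV, _⟩ := abs_le.1 (hE2 ω h0)
    have hexp : Real.exp (-(qA ω) / 2 - qφ0 ω / 2 - E₀) * Real.exp (-((C₁ + C₂) * vol))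
        ≤ Real.exp (-(qA ω) / 2 - qφ0 ω / 2 + V ω - E₀ - C₁ * vol) := by
      rw [← Real.exp_add]
      exact Real.exp_le_exp.2 (by linarith)
    calc χsm ω * (ZK * Real.exp (-(qA ω) / 2 - qφ0 ω / 2 - E₀)) * Real.exp (-((C₁ + C₂) * vol))
        = χsm ω * (ZK * (Real.exp (-(qA ω) / 2 - qφ0 ω / 2 - E₀) * Real.exp (-((C₁ + C₂) * vol)))) := by ring
      _ ≤ χK ω * (ZK * Real.exp (-(qA ω) / 2 - qφ0 ω / 2 + V ω - E₀ - C₁ * vol)) :=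
          mul_le_mul (hE3 ω) (mul_le_mul_of_nonneg_left hexp hZK)
            (mul_nonneg hZK (mul_nonneg (Real.exp_nonneg _) (Real.exp_nonneg _))) (hχK ω).1
      _ ≤ χK ω * Real.exp (-S ω) := mul_le_mul_of_nonneg_left (hE1 ω h0) (hχK ω).1

end Assembly

/-! ## §3 The accumulated errors `Σ_{j<K} O(1)(L^jε)^{κ₀}|T_ε|` are `O(1)|T_ε|`, uniformly in `K` and `ε` -/

/-- `Σ_{j<K}(L^jε)^{κ₀} ≤ (L^Kε)^{κ₀}/(L^{κ₀} − 1)` for `L > 1`, `κ₀ > 0`, `ε > 0`: the geometric sum `ε^{κ₀}Σ_{j<K}(L^{κ₀})^j =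
ε^{κ₀}(L^{Kκ₀} − 1)/(L^{κ₀} − 1)`.  This is why the factor `exp(Σ_{j=0}^{k−1}O(1)(L^jε)^{κ₀}|T_ε|)` carried by (3.26)/(3.37) is
`exp(O(1)|T_ε|)` at `k = K` ((3.66)–(3.68)). [cite: Balaban1982Higgs1, (3.66) p.624] -/
theorem sum_scalePow_le {L ε κ₀ : ℝ} (hL : 1 < L) (hε : 0 < ε) (hκ : 0 < κ₀) (K : ℕ) :
    ∑ j ∈ range K, (L ^ j * ε) ^ κ₀ ≤ (L ^ K * ε) ^ κ₀ / (L ^ κ₀ - 1) := by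
  have hL0 : 0 < L := lt_trans one_pos hL
  have hr1 : 1 < L ^ κ₀ := Real.one_lt_rpow hL hκ
  have hterm : ∀ j : ℕ, (L ^ j * ε) ^ κ₀ = ε ^ κ₀ * (L ^ κ₀) ^ j := by
    intro j
    rw [Real.mul_rpow (by positivity) hε.le, ← Real.rpow_natCast L j, ← Real.rpow_mul hL0.le,
      mul_comm (j : ℝ) κ₀, Real.rpow_mul hL0.le, Real.rpow_natCast]
    ring
  simp_rw [hterm]
  rw [← Finset.mul_sum, geom_sum_eq hr1.ne' K, mul_div_assoc]
  refine mul_le_mul_of_nonneg_left ?_ (by positivity)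
  exact div_le_div_of_nonneg_right (by linarith [pow_pos (lt_trans one_pos hr1) K]) (by linarith)

/-- With the stopping rule `L^Kε ≤ ε₀` (p. 624): `Σ_{j<K}(L^jε)^{κ₀} ≤ ε₀^{κ₀}/(L^{κ₀} − 1)` — a bound depending on `ε₀`, `L`,
`κ₀` only (*"a constant O(1) which in general depends on L^Kε, thus on ε₀"*, p. 625). [cite: Balaban1982Higgs1, (3.67)–(3.68) p.625] -/
theorem sum_scalePow_le_eps0 {L ε κ₀ ε₀ : ℝ} (hL : 1 < L) (hε : 0 < ε) (hκ : 0 < κ₀) (K : ℕ) (hK : L ^ K * ε ≤ ε₀) :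
    ∑ j ∈ range K, (L ^ j * ε) ^ κ₀ ≤ ε₀ ^ κ₀ / (L ^ κ₀ - 1) := by
  have hr1 : 1 < L ^ κ₀ := Real.one_lt_rpow hL hκ
  refine (sum_scalePow_le hL hε hκ K).trans (div_le_div_of_nonneg_right ?_ (by linarith))
  exact Real.rpow_le_rpow (by positivity) hK hκ.le

/-- **(3.67) with ONE explicit `O(1)` multiplying `|T_ε|`**, uniform in `K` and `ε` (given `L^Kε ≤ ε₀`): `Z^ε ≥ (∫ χsm·ZK·
exp(−½qA − ½qφ0 − E₀) dμ)·exp(−(C₁ + C₂ + C·ε₀^{κ₀}/(L^{κ₀} − 1))·|T_ε|)` (`C, |T_ε| ≥ 0`, `errK = Σ_{j<K}(L^jε)^{κ₀}`).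
[cite: Balaban1982Higgs1, (3.67) p.625] -/
theorem ineq367_O1 {Ω : Type*} [MeasurableSpace Ω] (μ : Measure Ω) {S qA qφ0 V χK χsm : Ω → ℝ}
    {Z ZK E₀ C C₁ C₂ vol L ε κ₀ ε₀ : ℝ} {K : ℕ} (hZK : 0 ≤ ZK) (hC : 0 ≤ C) (hvol : 0 ≤ vol)
    (hL : 1 < L) (hε : 0 < ε) (hκ : 0 < κ₀) (hK : L ^ K * ε ≤ ε₀)
    (h326 : (∫ ω, χK ω * Real.exp (-S ω) ∂μ)
      * Real.exp (-(C * (∑ j ∈ range K, (L ^ j * ε) ^ κ₀) * vol)) ≤ Z)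
    (hχK : ∀ ω, χK ω ∈ Set.Icc (0 : ℝ) 1) (hint : Integrable (fun ω => χK ω * Real.exp (-S ω)) μ)
    (hE1 : ∀ ω, χK ω ≠ 0 →
      ZK * Real.exp (-(qA ω) / 2 - qφ0 ω / 2 + V ω - E₀ - C₁ * vol) ≤ Real.exp (-S ω))
    (hE2 : ∀ ω, χK ω ≠ 0 → |V ω| ≤ C₂ * vol)
    (hχsm0 : ∀ ω, 0 ≤ χsm ω) (hE3 : ∀ ω, χsm ω ≤ χK ω) :
    (∫ ω, χsm ω * (ZK * Real.exp (-(qA ω) / 2 - qφ0 ω / 2 - E₀)) ∂μ)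
        * Real.exp (-((C₁ + C₂ + C * (ε₀ ^ κ₀ / (L ^ κ₀ - 1))) * vol)) ≤ Z := by
  have h367 := ineq367 μ hZK h326 hχK hint hE1 hE2 hχsm0 hE3
  have hI : 0 ≤ ∫ ω, χsm ω * (ZK * Real.exp (-(qA ω) / 2 - qφ0 ω / 2 - E₀)) ∂μ :=
    integral_nonneg fun ω => mul_nonneg (hχsm0 ω) (mul_nonneg hZK (Real.exp_nonneg _))
  have hsum := sum_scalePow_le_eps0 hL hε hκ K hK
  refine le_trans ?_ h367
  rw [mul_assoc, ← Real.exp_add]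
  refine mul_le_mul_of_nonneg_left (Real.exp_le_exp.2 ?_) hI
  have : C * (∑ j ∈ range K, (L ^ j * ε) ^ κ₀) * vol ≤ C * (ε₀ ^ κ₀ / (L ^ κ₀ - 1)) * vol :=
    mul_le_mul_of_nonneg_right (mul_le_mul_of_nonneg_left hsum hC) hvol
  nlinarith

end Literature.MathematicalPhysics.QuantumFieldTheory.Balaban1983to89.B1Ineq367Proof
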